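import Summits.QuantumFields.BalabanUV.Beta.FP.StepRecursionFeedNestedCompDoor
import Summits.QuantumFields.BalabanUV.Beta.FP.PerfectBubbleExpansion

/-!
# `BalabanUV.Beta.FP.StepRecursionFeedNestedCompDoorMoments` — road «FP» for binder row D1: **THE DOOR AS A LOCALISED SECOND-ORDER FAMILY, AND
# THE BINDER AS ITS TADPOLE's THREE DECIMATED MOMENTS** (SPEC-64 §10 (ii-A″) + (3): «an4's `hD0 ∕ hD1 ∕ hD2` shapes ARE G2-M2's folds `M0Δ ∕ M1Δ ∕ M2Δ`»,
# typed on `ℤ⁴`; `StepRecursionFeedNestedCompDoor` BY NAME; `hDA` and `hWΔ` DISCHARGED from the door letter in the N-side's own shape)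

WHY.  `…CompDoor` (p653301) feeds the door family `𝒲Δ` as N-data and concludes `D1Tel` ∕ `D1Sum` from an4's four remainder binders ON THE TADPOLE
DEFECT `D j c e z := −½·tadpole (AN j) (𝒲Δ j c 0 e z)`: `hD0` (`HasSum (D j c e) 0`), `hD1` (`HasSum (z ρ • D j c e z) 0`), `hDA` (`AbsMoment₂ (D j c e)`),
`hD2` (`m2Tensor (D j) = 0`) — resp. `hDF` (`secondMoment (D j) μ ν = 0`) — with the door's localisation displayed member by member (`hWΔ : Loc (𝒲Δ j μ 0 ν z)`).
Two of these are bookkeeping once the door letter is stated in the N-side's OWN shape — the shape of an2's `NVertexParities.vertexFamily₂_WN` for the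
record family: `hWΔ₂ : ∀ j, ∃ Cw δw, 0 < δw ∧ VertexFamily₂ (𝒲Δ j) (Lc^(j+1)) Cw δw` (every member bi-localised at its two coarse bonds, ONE constant, ONE
rate).  Then (i) `Loc` of every member is immediate, and (ii) the summability binder `hDA` is a THEOREM: the tadpole of a spread leg against a localised
second-order family has the (5.10)-shape decay in the relative bond position (road `PerfectBubbleExpansion.absMoment₂_tadpolePart`, from Literature
`decay510_hessKer`; an4 `absMoment₂_const_mul'`).  What is left of an4's rows is then LITERALLY the three lattice folds of the RAW door tadpole
`τ_j(c,e,z) := tadpole (AN j) (𝒲Δ j c 0 e z)`: `M0: ∑' z, τ_j(c,e,z) = 0`, `M1: ∑' z, z_ρ·τ_j(c,e,z) = 0`, `M2: ∑' z, z_κ z_λ·τ_j(c,e,z) = 0` (the `−½` drops) —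
resp., at the read-out level, the ONE (1.22) component `∑' x, x_μ x_ν·τ_j(μ,ν,x) = 0` — i.e. EXACTLY the decimated moments `M0Δ ∕ M1Δ ∕ M2Δ` (and the
(1.22) read-out line) that SPEC-64 §10 (3) registered and that the by-value gate G2-M2 ∕ G2-M2′ folds (Engine C K2L-DTAD at p = 4; K2L-M2P7 at p = 7,
requests l.4525) — there on a coarse TORUS window (periodised; containment gate `C_p`, (3′)), here on `ℤ⁴` (no periodisation).  This file types that
sentence.  Consumer class: composition BY NAME over p653301; no law, no v10, nothing on the H-side (policy pinned by value, SPEC-64 §10 (4)).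

WHAT.  Blocking `Lc` (`[NeZero Lc]`, `Odd Lc`), dimension four, ROOT M‴'s `Js` UNCHANGED, `Jc := JcComp hLc N cΛ cB R P`.
* §1 [folklore] generic letters: `absMoment₂_tadpoleDefect` (`Spr A`, `VertexFamily₂ W N …`, `1 ≤ N` ⟹ `AbsMoment₂ (z ↦ r·tadpole A (W c 0 e z))`; a localised family's
  members are `Loc` — TREE `GAN24.WSlotParityBlind.loc_of_vertexFamily₂` BY NAME, chair DOCFIX-4); and the four FOLD ↦ BINDER conversions — `hasSum_const_mul_of_tsum_eq_zero` (M0 ↦ `hD0`),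
  `hasSum_coord_smul_of_tsum_eq_zero` (M1 ↦ `hD1`; both need `AbsMoment₂`, supplied by the previous letter), `m2Tensor_eq_zero_of_tsum_coord2` (M2 ↦ `hD2`,
  unconditional algebra), `secondMoment_eq_zero_of_tsum_coord2` ((1.22) line ↦ `hDF`, unconditional algebra).
* §2 [folklore] **PER-STOREY SHAPE**: `d1Tel_JcComp_nested_of_fedW_moments_wStep` (+ `_ctr`) and `d1Sum_JcComp_ctr_nested_of_fedW_moments_wStep` — `…CompDoor` §2's
  rows with `hWΔ ↦ hWΔ₂`, `hDA` GONE, `hD0 hD1 hD2 ↦ hM0 hM1 hM2` (resp. `hDF ↦ hM2F`, the (1.22) component in channel `(μ, ν)`); `hlawΔ hF₁ htr hG hT0 hT1` VERBATIM.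
* §3 [folklore] **BASE-ONLY SHAPE**: `d1Tel_JcComp_ctr_nested_of_fedW_moments_fed_wStep` ∕ `d1Sum_…` — `…CompDoor` §3's rows (fed transport `htrΔ`, covariance
  row `hDΔtr` VERBATIM) with `hWΔ₂` (all storeys — it carries `hDA ∀ j`) and the three folds AT THE BASE ONLY `hM0₁ hM1₁ hM2₁` (resp. `hM2F₁`) — the folds
  G2-M2′ measures at n = 0.
[folklore] composition BY NAME + four lines of `tsum` algebra; no `def`, no `def … : Prop`, nothing cited, 0 sorry.  Every displayed row is a HYPOTHESIS;
nothing of the dictionary ∕ Bałaban's asserted, valued or discharged; NO fold ∕ moment ∕ tadpole claimed to vanish, to be covariant or to be invisible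
(G2-M2′ ∕ G3 pending or unmeasured, zero weight; by value at p = 4: `M0Δ = 0` 16∕16, `M2` undecided — SPEC-64 §11, zero weight); `hWΔ₂` NOT discharged
(the row's ONE file); targets `D1Tel`∕`D1Sum` UNCHANGED ((ii-D) NOT typed); NOT a law file; no existing file touched.

HONEST DEPENDENCY (page 1, mandatory): continuum YM on T⁴ ⇐ BetaPertH ∧ nine spine estimates (0/9 proved); BetaPertH ⇐ (D1) ∧ (D4) ∧ CAP+tail;
G-an2-4 gates asym, D1 and NE2/3/4.  HONEST FRAMING (cell contract, verbatim): «discharging `BetaPertH` makes Bałaban's UV stability UNCONDITIONAL —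
a real constructive-QFT result; it is NOT the continuum limit and NOT the Clay problem.»  ABSOLUTE RULE (cell charter, verbatim): «No internally-minted
statement may enter as a cited fact. Every hypothesis is either kernel-proved in this package or a verbatim quotation of a PUBLISHED theorem with page
reference. The manuscript(s) under audit are NOT citable for their own disputed steps — they are the thing under adjudication; programme-internal
(2001/route/tribunal) claims are never citable.»  0 estimates; 0∕4 row-D1 binders (hW, hR, D1Tel, D1Rep); ROOT M‴ p325680 untouched; NOT (C1), NOT (L2′)
beyond `hN`'s name, NOT (T-ID), NOT SDF, NOT D1, NEVER «G-an2-4 closed», NOT BetaPertH, NOT continuum, NOT Clay.  Road «FP» OWNER, b2b-balaban-beta-d1-p3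
gen 52, 2026-08-28.  No existing file touched.
-/

noncomputable section

namespace Summit.QuantumFields.BalabanUV.Beta.FP.StepRecursionFeedNestedCompDoorMoments

open Finset
open Literature.MathematicalPhysics.QuantumFieldTheory
open Literature.MathematicalPhysics.QuantumFieldTheory.Balaban1983to89
open Literature.MathematicalPhysics.QuantumFieldTheory.Balaban1983to89.Beta
open Literature.MathematicalPhysics.QuantumFieldTheory.Balaban1983to89.B12Beta (secondMoment)
open DecimatedMomentSummable (AbsMoment₂ IsMoment₂ summable_of_absMoment₂ summable_smul_of_absMoment₂)
open DressedMomentNormalisation (EKer dressedEntry m2Tensor)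
open ExpKernelCalculus (Site MKer tadpole hessKer VertexFamily₂)
open OneStepResolventKernel (Fib JetData)
open OneStepKernelFamily (TshotOf TbalOf D1Tel)
open HessianTelescopingKKT (wStep absMoment₂_const_mul')
open StepDriftWitness (D1Sum)
open Summit.QuantumFields.BalabanUV.Beta.TameKernelCalculus (Spr Loc)
open Summit.QuantumFields.BalabanUV.Beta.SymSecondOrderTablesAn1 (symTablesAn1S2)
open Summit.QuantumFields.BalabanUV.Beta.CombChartJointEnd (JsB12CombShSym)
open Summit.QuantumFields.BalabanUV.Beta.CompositeOneShotJetData (Roots Pins JcComp AN VN WN)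
open Summit.QuantumFields.BalabanUV.Beta.FP.TowerNParityRowsEven (spr_AN)
open Summit.QuantumFields.BalabanUV.Beta.FP.PerfectBubbleExpansion (absMoment₂_tadpolePart)
open Summit.QuantumFields.BalabanUV.Beta.GAN24.WSlotParityBlind (loc_of_vertexFamily₂)
open Summit.QuantumFields.BalabanUV.Beta.FP.StepRecursionFeedNestedCompDoor
  (d1Tel_JcComp_nested_of_hessKer_laws_fedW_wStep d1Sum_JcComp_ctr_nested_of_hessKer_laws_fedW_wStep
    d1Tel_JcComp_ctr_nested_of_hessKer_laws_fedW_fed_wStep d1Sum_JcComp_ctr_nested_of_hessKer_laws_fedW_fed_wStep)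

/-! ## §1 Letters: the tadpole defect has an absolutely summable second moment; folds ↦ binders (`Loc` of the members: `WSlotParityBlind.loc_of_vertexFamily₂`) -/

section Letters

variable {D : ℕ} {F : Type*} [Fintype F]

/-- [folklore] **an4's `hDA` FROM THE DOOR LETTER**: a spread leg `A` and a localised second-order family `W` (blocking `N ≥ 1`) ⟹ the scaled tadpole
`z ↦ r·tadpole A (W c 0 e z)` has an absolutely summable second moment (road `PerfectBubbleExpansion.absMoment₂_tadpolePart` — the (5.10)-shape decay of
the tadpole half, Literature `decay510_hessKer` — and an4 `absMoment₂_const_mul'`). -/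
theorem absMoment₂_tadpoleDefect {A : MKer D F} (hA : Spr A) {W : Fin D → Site D → Fin D → Site D → MKer D F} {N : ℕ}
    (hW : ∃ Cw δw : ℝ, 0 < δw ∧ VertexFamily₂ W N Cw δw) (hN : 1 ≤ N) (r : ℝ) (c e : Fin D) :
    AbsMoment₂ (fun z : Site D => r * tadpole A (W c 0 e z)) :=
  absMoment₂_const_mul' (absMoment₂_tadpolePart hA hW hN c e) r

variable {d : ℕ}

/-- [folklore] **M0 ↦ `hD0`**: for `t` with an absolutely summable second moment, `∑' z, t z = 0` ⟹ `HasSum (z ↦ r·t z) 0`. -/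
theorem hasSum_const_mul_of_tsum_eq_zero {t : (Fin d → ℤ) → ℝ} (ht : AbsMoment₂ t) (h0 : ∑' z, t z = 0) (r : ℝ) :
    HasSum (fun z : Fin d → ℤ => r * t z) 0 := by
  have hs : Summable (fun z : Fin d → ℤ => r * t z) := (summable_of_absMoment₂ ht).mul_left r
  have e : ∑' z : Fin d → ℤ, r * t z = 0 := by rw [tsum_mul_left, h0, mul_zero]
  rw [← e]
  exact hs.hasSum

/-- [folklore] **M1 ↦ `hD1`**: for `t` with an absolutely summable second moment, `∑' z, z_ρ·t z = 0` ⟹ `HasSum (z ↦ z ρ • (r·t z)) 0`. -/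
theorem hasSum_coord_smul_of_tsum_eq_zero {t : (Fin d → ℤ) → ℝ} (ht : AbsMoment₂ t) (ρ : Fin d)
    (h1 : ∑' z : Fin d → ℤ, (z ρ : ℝ) * t z = 0) (r : ℝ) :
    HasSum (fun z : Fin d → ℤ => z ρ • (r * t z)) 0 := by
  have hs : Summable (fun z : Fin d → ℤ => z ρ • (r * t z)) :=
    summable_smul_of_absMoment₂ (absMoment₂_const_mul' ht r) (IsMoment₂.coord ρ)
  have e : ∑' z : Fin d → ℤ, z ρ • (r * t z) = 0 := by
    rw [show (fun z : Fin d → ℤ => z ρ • (r * t z)) = fun z => r * ((z ρ : ℝ) * t z) from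
      funext fun z => by rw [zsmul_eq_mul]; ring, tsum_mul_left, h1, mul_zero]
  rw [← e]
  exact hs.hasSum

/-- [folklore] **M2 ↦ `hD2`** (unconditional algebra): `∑' z, z_κ z_λ·T c e z = 0` for all `κ λ c e` ⟹ `m2Tensor (c e z ↦ r·T c e z) = 0`. -/
theorem m2Tensor_eq_zero_of_tsum_coord2 {T : EKer 4} (h2 : ∀ κ l c e : Fin 4, ∑' z : Fin 4 → ℤ, ((z κ : ℝ) * (z l : ℝ)) * T c e z = 0) (r : ℝ) :
    m2Tensor (fun c e z => r * T c e z) = 0 := by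
  funext κ l a b
  show (∑' z : Fin 4 → ℤ, (z κ * z l) • (r * T a b z)) = 0
  rw [show (fun z : Fin 4 → ℤ => (z κ * z l) • (r * T a b z)) = fun z => r * (((z κ : ℝ) * (z l : ℝ)) * T a b z) from
    funext fun z => by rw [zsmul_eq_mul, Int.cast_mul]; ring, tsum_mul_left, h2, mul_zero]

/-- [folklore] **THE (1.22) READ-OUT LINE ↦ `hDF`** (unconditional algebra): `∑' x, x_μ x_ν·T μ ν x = 0` ⟹ `secondMoment (c e x ↦ r·T c e x) μ ν = 0`. -/
theorem secondMoment_eq_zero_of_tsum_coord2 {T : EKer d} (μ ν : Fin d) (h : ∑' x : Fin d → ℤ, ((x μ : ℝ) * (x ν : ℝ)) * T μ ν x = 0) (r : ℝ) :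
    secondMoment (fun c e x => r * T c e x) μ ν = 0 := by
  show (∑' x : Fin d → ℤ, r * T μ ν x * (x μ : ℝ) * (x ν : ℝ)) = 0
  rw [show (fun x : Fin d → ℤ => r * T μ ν x * (x μ : ℝ) * (x ν : ℝ)) = fun x => r * (((x μ : ℝ) * (x ν : ℝ)) * T μ ν x) from
    funext fun x => by ring, tsum_mul_left, h, mul_zero]

end Letters

/-! ## §2 Per-storey shape: the door as a localised family, the binder as its tadpole's three folds at every storey -/

section PerStorey

variable {Lc : ℕ} [NeZero Lc] {FF FG : Type*} [Fintype FF] [Fintype FG]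

/-- [folklore] **ROOT M‴'s `htel` AT THE RECORD PAIR, NESTED CURRENCY, THE DOOR A LOCALISED FAMILY, THE BINDER ITS TADPOLE's FOLDS** (SPEC-64 §10 (ii-A″)+(3),
`…CompDoor` §2 shape).  DISPLAYED: the door family `𝒲Δ j` with its letter IN THE N-SIDE's SHAPE `hWΔ₂ : ∃ Cw δw, 0 < δw ∧ VertexFamily₂ (𝒲Δ j) (Lc^(j+1)) Cw δw`;
the kernel law FOR THE FED FAMILY `hlawΔ`; #31's `hF₁ htr hG` (T0)(T1) VERBATIM; and THE THREE LATTICE FOLDS OF THE RAW DOOR TADPOLE at every storey `j ≥ 1` —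
`hM0 : ∑' z, tadpole (AN R j) (𝒲Δ j c 0 e z) = 0`, `hM1 : ∑' z, z_ρ·(…) = 0`, `hM2 : ∑' z, z_κ z_λ·(…) = 0` — ⟹ `D1Tel Lc Js (JcComp hLc N cΛ cB R P)`.
`Loc` of the members and an4's `hDA` are theorems (inside, §1). -/
theorem d1Tel_JcComp_nested_of_fedW_moments_wStep (hLc : Odd Lc) (N : ℕ) (cΛ cB : ℝ) (R : Roots Lc) (P : Pins)
    (AF : ℕ → MKer 4 FF) (𝒱F : ℕ → Fin 4 → (Fin 4 → ℤ) → MKer 4 FF) (𝒲F : ℕ → Fin 4 → (Fin 4 → ℤ) → Fin 4 → (Fin 4 → ℤ) → MKer 4 FF)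
    (AG : ℕ → MKer 4 FG) (𝒱G : ℕ → Fin 4 → (Fin 4 → ℤ) → MKer 4 FG) (𝒲G : ℕ → Fin 4 → (Fin 4 → ℤ) → Fin 4 → (Fin 4 → ℤ) → MKer 4 FG)
    -- THE DOOR FAMILY, DISPLAYED AS DATA, with its localisation letter IN THE N-SIDE's SHAPE
    (𝒲Δ : ℕ → Fin (3 + 1) → Site (3 + 1) → Fin (3 + 1) → Site (3 + 1) → MKer (3 + 1) (Fib 3))
    (hWΔ₂ : ∀ j : ℕ, ∃ Cw δw : ℝ, 0 < δw ∧ VertexFamily₂ (𝒲Δ j) (Lc ^ (j + 1)) Cw δw)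
    -- THE KERNEL LAW FOR THE FED FAMILY (N-side placement)
    (hlawΔ : ∀ j : ℕ, 1 ≤ j → ∀ (μ ν : Fin 4) (z : Fin 4 → ℤ),
      hessKer (AN R j) (VN R P j) (WN R P j + 𝒲Δ j) μ ν z
        = hessKer (AF j) (𝒱F j) (𝒲F j) μ ν z + hessKer (AG j) (𝒱G j) (𝒲G j) μ ν z)
    (hF₁ : ∀ (μ ν : Fin 4) (z : Fin 4 → ℤ),
      hessKer (AF 1) (𝒱F 1) (𝒲F 1) μ ν z
        = (Lc : ℝ) ^ 8 * dressedEntry (wStep Lc 1) (TshotOf Lc (JcComp hLc N cΛ cB R P) 1) ((Lc : ℤ) • z) μ ν)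
    (htr : ∀ j : ℕ, 1 ≤ j → ∀ (μ ν : Fin 4) (z : Fin 4 → ℤ),
      hessKer (AF (j + 1)) (𝒱F (j + 1)) (𝒲F (j + 1)) μ ν z
        = (Lc : ℝ) ^ 8 * dressedEntry (wStep Lc (j + 1)) (hessKer (AN R j) (VN R P j) (WN R P j)) ((Lc : ℤ) • z) μ ν)
    (hG : ∀ j : ℕ, 1 ≤ j → ∀ (μ ν : Fin 4) (z : Fin 4 → ℤ),
      hessKer (AG j) (𝒱G j) (𝒲G j) μ ν z = TbalOf Lc (JsB12CombShSym hLc N (symTablesAn1S2 3 Lc cΛ) cΛ cB) j μ ν z)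
    (hT0 : ∀ j (c e : Fin 4), HasSum (TbalOf Lc (JsB12CombShSym hLc N (symTablesAn1S2 3 Lc cΛ) cΛ cB) j c e) 0)
    (hT1 : ∀ j (c e ρ : Fin 4), HasSum (fun t : Fin 4 → ℤ => t ρ • TbalOf Lc (JsB12CombShSym hLc N (symTablesAn1S2 3 Lc cΛ) cΛ cB) j c e t) 0)
    -- THE THREE LATTICE FOLDS OF THE RAW DOOR TADPOLE (SPEC-64 §10 (3): M0Δ, M1Δ, M2Δ), every storey
    (hM0 : ∀ j, 1 ≤ j → ∀ c e : Fin 4, ∑' z : Fin 4 → ℤ, tadpole (AN R j) (𝒲Δ j c 0 e z) = 0)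
    (hM1 : ∀ j, 1 ≤ j → ∀ c e ρ : Fin 4, ∑' z : Fin 4 → ℤ, (z ρ : ℝ) * tadpole (AN R j) (𝒲Δ j c 0 e z) = 0)
    (hM2 : ∀ j, 1 ≤ j → ∀ κ l c e : Fin 4, ∑' z : Fin 4 → ℤ, ((z κ : ℝ) * (z l : ℝ)) * tadpole (AN R j) (𝒲Δ j c 0 e z) = 0) :
    D1Tel Lc (JsB12CombShSym hLc N (symTablesAn1S2 3 Lc cΛ) cΛ cB) (JcComp hLc N cΛ cB R P) :=
  d1Tel_JcComp_nested_of_hessKer_laws_fedW_wStep hLc N cΛ cB R P AF 𝒱F 𝒲F AG 𝒱G 𝒲G 𝒲Δ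
    (fun j μ ν z => by
      obtain ⟨Cw, δw, hδw, hW⟩ := hWΔ₂ j
      exact loc_of_vertexFamily₂ hW hδw μ 0 ν z)
    hlawΔ hF₁ htr hG hT0 hT1
    (fun j hj c e => hasSum_const_mul_of_tsum_eq_zero (absMoment₂_tadpolePart (spr_AN R j) (hWΔ₂ j) (Nat.one_le_pow _ _ (Nat.pos_of_neZero Lc)) c e) (hM0 j hj c e) _)
    (fun j hj c e ρ => hasSum_coord_smul_of_tsum_eq_zero (absMoment₂_tadpolePart (spr_AN R j) (hWΔ₂ j) (Nat.one_le_pow _ _ (Nat.pos_of_neZero Lc)) c e) ρ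
      (hM1 j hj c e ρ) _)
    (fun j _ c e => absMoment₂_tadpoleDefect (spr_AN R j) (hWΔ₂ j) (Nat.one_le_pow _ _ (Nat.pos_of_neZero Lc)) _ c e)
    (fun j hj => m2Tensor_eq_zero_of_tsum_coord2 (T := fun c e z => tadpole (AN R j) (𝒲Δ j c 0 e z)) (fun κ l c e => hM2 j hj κ l c e) _)

/-- [folklore] **THE (β1) TOWER's INSTANCE** — the same at `R := Roots.ctr Lc`. -/
theorem d1Tel_JcComp_ctr_nested_of_fedW_moments_wStep (hLc : Odd Lc) (N : ℕ) (cΛ cB : ℝ) (P : Pins)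
    (AF : ℕ → MKer 4 FF) (𝒱F : ℕ → Fin 4 → (Fin 4 → ℤ) → MKer 4 FF) (𝒲F : ℕ → Fin 4 → (Fin 4 → ℤ) → Fin 4 → (Fin 4 → ℤ) → MKer 4 FF)
    (AG : ℕ → MKer 4 FG) (𝒱G : ℕ → Fin 4 → (Fin 4 → ℤ) → MKer 4 FG) (𝒲G : ℕ → Fin 4 → (Fin 4 → ℤ) → Fin 4 → (Fin 4 → ℤ) → MKer 4 FG)
    (𝒲Δ : ℕ → Fin (3 + 1) → Site (3 + 1) → Fin (3 + 1) → Site (3 + 1) → MKer (3 + 1) (Fib 3))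
    (hWΔ₂ : ∀ j : ℕ, ∃ Cw δw : ℝ, 0 < δw ∧ VertexFamily₂ (𝒲Δ j) (Lc ^ (j + 1)) Cw δw)
    (hlawΔ : ∀ j : ℕ, 1 ≤ j → ∀ (μ ν : Fin 4) (z : Fin 4 → ℤ),
      hessKer (AN (Roots.ctr Lc) j) (VN (Roots.ctr Lc) P j) (WN (Roots.ctr Lc) P j + 𝒲Δ j) μ ν z
        = hessKer (AF j) (𝒱F j) (𝒲F j) μ ν z + hessKer (AG j) (𝒱G j) (𝒲G j) μ ν z)
    (hF₁ : ∀ (μ ν : Fin 4) (z : Fin 4 → ℤ),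
      hessKer (AF 1) (𝒱F 1) (𝒲F 1) μ ν z
        = (Lc : ℝ) ^ 8 * dressedEntry (wStep Lc 1) (TshotOf Lc (JcComp hLc N cΛ cB (Roots.ctr Lc) P) 1) ((Lc : ℤ) • z) μ ν)
    (htr : ∀ j : ℕ, 1 ≤ j → ∀ (μ ν : Fin 4) (z : Fin 4 → ℤ),
      hessKer (AF (j + 1)) (𝒱F (j + 1)) (𝒲F (j + 1)) μ ν z
        = (Lc : ℝ) ^ 8 * dressedEntry (wStep Lc (j + 1))
            (hessKer (AN (Roots.ctr Lc) j) (VN (Roots.ctr Lc) P j) (WN (Roots.ctr Lc) P j)) ((Lc : ℤ) • z) μ ν)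
    (hG : ∀ j : ℕ, 1 ≤ j → ∀ (μ ν : Fin 4) (z : Fin 4 → ℤ),
      hessKer (AG j) (𝒱G j) (𝒲G j) μ ν z = TbalOf Lc (JsB12CombShSym hLc N (symTablesAn1S2 3 Lc cΛ) cΛ cB) j μ ν z)
    (hT0 : ∀ j (c e : Fin 4), HasSum (TbalOf Lc (JsB12CombShSym hLc N (symTablesAn1S2 3 Lc cΛ) cΛ cB) j c e) 0)
    (hT1 : ∀ j (c e ρ : Fin 4), HasSum (fun t : Fin 4 → ℤ => t ρ • TbalOf Lc (JsB12CombShSym hLc N (symTablesAn1S2 3 Lc cΛ) cΛ cB) j c e t) 0)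
    (hM0 : ∀ j, 1 ≤ j → ∀ c e : Fin 4, ∑' z : Fin 4 → ℤ, tadpole (AN (Roots.ctr Lc) j) (𝒲Δ j c 0 e z) = 0)
    (hM1 : ∀ j, 1 ≤ j → ∀ c e ρ : Fin 4, ∑' z : Fin 4 → ℤ, (z ρ : ℝ) * tadpole (AN (Roots.ctr Lc) j) (𝒲Δ j c 0 e z) = 0)
    (hM2 : ∀ j, 1 ≤ j → ∀ κ l c e : Fin 4,
      ∑' z : Fin 4 → ℤ, ((z κ : ℝ) * (z l : ℝ)) * tadpole (AN (Roots.ctr Lc) j) (𝒲Δ j c 0 e z) = 0) :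
    D1Tel Lc (JsB12CombShSym hLc N (symTablesAn1S2 3 Lc cΛ) cΛ cB) (JcComp hLc N cΛ cB (Roots.ctr Lc) P) :=
  d1Tel_JcComp_nested_of_fedW_moments_wStep hLc N cΛ cB (Roots.ctr Lc) P AF 𝒱F 𝒲F AG 𝒱G 𝒲G 𝒲Δ hWΔ₂ hlawΔ hF₁ htr hG hT0 hT1 hM0 hM1 hM2

/-- [folklore] **THE READ-OUT-LEVEL TWIN** (channel `(μ, ν)`, (β1) instance): the same rows with the ONE (1.22) READ-OUT COMPONENT of the fold
`hM2F : ∑' x, x_μ x_ν·tadpole (AN j) (𝒲Δ j μ 0 ν x) = 0` (`j ≥ 1`) in place of `hM2` ⟹ the lead's `D1Sum Lc Js (JcComp … (Roots.ctr Lc) P) μ ν`. -/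
theorem d1Sum_JcComp_ctr_nested_of_fedW_moments_wStep (hLc : Odd Lc) (N : ℕ) (cΛ cB : ℝ) (P : Pins)
    (AF : ℕ → MKer 4 FF) (𝒱F : ℕ → Fin 4 → (Fin 4 → ℤ) → MKer 4 FF) (𝒲F : ℕ → Fin 4 → (Fin 4 → ℤ) → Fin 4 → (Fin 4 → ℤ) → MKer 4 FF)
    (AG : ℕ → MKer 4 FG) (𝒱G : ℕ → Fin 4 → (Fin 4 → ℤ) → MKer 4 FG) (𝒲G : ℕ → Fin 4 → (Fin 4 → ℤ) → Fin 4 → (Fin 4 → ℤ) → MKer 4 FG)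
    (𝒲Δ : ℕ → Fin (3 + 1) → Site (3 + 1) → Fin (3 + 1) → Site (3 + 1) → MKer (3 + 1) (Fib 3))
    (hWΔ₂ : ∀ j : ℕ, ∃ Cw δw : ℝ, 0 < δw ∧ VertexFamily₂ (𝒲Δ j) (Lc ^ (j + 1)) Cw δw) (μ ν : Fin 4)
    (hlawΔ : ∀ j : ℕ, 1 ≤ j → ∀ (μ ν : Fin 4) (z : Fin 4 → ℤ),
      hessKer (AN (Roots.ctr Lc) j) (VN (Roots.ctr Lc) P j) (WN (Roots.ctr Lc) P j + 𝒲Δ j) μ ν z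
        = hessKer (AF j) (𝒱F j) (𝒲F j) μ ν z + hessKer (AG j) (𝒱G j) (𝒲G j) μ ν z)
    (hF₁ : ∀ (μ ν : Fin 4) (z : Fin 4 → ℤ),
      hessKer (AF 1) (𝒱F 1) (𝒲F 1) μ ν z
        = (Lc : ℝ) ^ 8 * dressedEntry (wStep Lc 1) (TshotOf Lc (JcComp hLc N cΛ cB (Roots.ctr Lc) P) 1) ((Lc : ℤ) • z) μ ν)
    (htr : ∀ j : ℕ, 1 ≤ j → ∀ (μ ν : Fin 4) (z : Fin 4 → ℤ),
      hessKer (AF (j + 1)) (𝒱F (j + 1)) (𝒲F (j + 1)) μ ν z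
        = (Lc : ℝ) ^ 8 * dressedEntry (wStep Lc (j + 1))
            (hessKer (AN (Roots.ctr Lc) j) (VN (Roots.ctr Lc) P j) (WN (Roots.ctr Lc) P j)) ((Lc : ℤ) • z) μ ν)
    (hG : ∀ j : ℕ, 1 ≤ j → ∀ (μ ν : Fin 4) (z : Fin 4 → ℤ),
      hessKer (AG j) (𝒱G j) (𝒲G j) μ ν z = TbalOf Lc (JsB12CombShSym hLc N (symTablesAn1S2 3 Lc cΛ) cΛ cB) j μ ν z)
    (hT0 : ∀ j (c e : Fin 4), HasSum (TbalOf Lc (JsB12CombShSym hLc N (symTablesAn1S2 3 Lc cΛ) cΛ cB) j c e) 0)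
    (hT1 : ∀ j (c e ρ : Fin 4), HasSum (fun t : Fin 4 → ℤ => t ρ • TbalOf Lc (JsB12CombShSym hLc N (symTablesAn1S2 3 Lc cΛ) cΛ cB) j c e t) 0)
    (hM0 : ∀ j, 1 ≤ j → ∀ c e : Fin 4, ∑' z : Fin 4 → ℤ, tadpole (AN (Roots.ctr Lc) j) (𝒲Δ j c 0 e z) = 0)
    (hM1 : ∀ j, 1 ≤ j → ∀ c e ρ : Fin 4, ∑' z : Fin 4 → ℤ, (z ρ : ℝ) * tadpole (AN (Roots.ctr Lc) j) (𝒲Δ j c 0 e z) = 0)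
    (hM2F : ∀ j, 1 ≤ j → ∑' x : Fin 4 → ℤ, ((x μ : ℝ) * (x ν : ℝ)) * tadpole (AN (Roots.ctr Lc) j) (𝒲Δ j μ 0 ν x) = 0) :
    D1Sum Lc (JsB12CombShSym hLc N (symTablesAn1S2 3 Lc cΛ) cΛ cB) (JcComp hLc N cΛ cB (Roots.ctr Lc) P) μ ν :=
  d1Sum_JcComp_ctr_nested_of_hessKer_laws_fedW_wStep hLc N cΛ cB P AF 𝒱F 𝒲F AG 𝒱G 𝒲G 𝒲Δ
    (fun j μ' ν' z => by
      obtain ⟨Cw, δw, hδw, hW⟩ := hWΔ₂ j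
      exact loc_of_vertexFamily₂ hW hδw μ' 0 ν' z)
    μ ν hlawΔ hF₁ htr hG hT0 hT1
    (fun j hj c e => hasSum_const_mul_of_tsum_eq_zero
      (absMoment₂_tadpolePart (spr_AN (Roots.ctr Lc) j) (hWΔ₂ j) (Nat.one_le_pow _ _ (Nat.pos_of_neZero Lc)) c e) (hM0 j hj c e) _)
    (fun j hj c e ρ => hasSum_coord_smul_of_tsum_eq_zero
      (absMoment₂_tadpolePart (spr_AN (Roots.ctr Lc) j) (hWΔ₂ j) (Nat.one_le_pow _ _ (Nat.pos_of_neZero Lc)) c e) ρ (hM1 j hj c e ρ) _)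
    (fun j _ c e => absMoment₂_tadpoleDefect (spr_AN (Roots.ctr Lc) j) (hWΔ₂ j) (Nat.one_le_pow _ _ (Nat.pos_of_neZero Lc)) _ c e)
    (fun j hj => secondMoment_eq_zero_of_tsum_coord2 (T := fun c e z => tadpole (AN (Roots.ctr Lc) j) (𝒲Δ j c 0 e z)) μ ν (hM2F j hj) _)

end PerStorey

/-! ## §3 Base-only shape: the fed transport and the covariance row verbatim; the three folds at the base only -/

section BaseOnly

variable {Lc : ℕ} [NeZero Lc] {FF FG : Type*} [Fintype FF] [Fintype FG]

/-- [folklore] **ROOT M‴'s `htel` AT THE RECORD PAIR, THE DOOR A LOCALISED FAMILY FED CONSISTENTLY, ITS TADPOLE DEFECT `htr`-COVARIANT, THE BINDER THE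
THREE FOLDS AT THE BASE** (`…CompDoor` §3 shape, (β1) instance).  DISPLAYED: `𝒲Δ`, `hWΔ₂` (every storey: it carries an4's `hDA ∀ j`); the law for the fed
family `hlawΔ`; `hF₁` door-free; the FED TRANSPORT FOR THE FED KERNEL `htrΔ`; `hG` (T0)(T1); the covariance row `hDΔtr` of the tadpole defect
`−½·tadpole (AN j) (𝒲Δ j μ 0 ν z)` VERBATIM; and the three lattice folds of the raw door tadpole AT THE BASE ONLY `hM0₁ hM1₁ hM2₁` (what G2-M2′ folds
at n = 0, SPEC-64 §10 (3), requests l.4525) ⟹ `D1Tel`. -/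
theorem d1Tel_JcComp_ctr_nested_of_fedW_moments_fed_wStep (hLc : Odd Lc) (N : ℕ) (cΛ cB : ℝ) (P : Pins)
    (AF : ℕ → MKer 4 FF) (𝒱F : ℕ → Fin 4 → (Fin 4 → ℤ) → MKer 4 FF) (𝒲F : ℕ → Fin 4 → (Fin 4 → ℤ) → Fin 4 → (Fin 4 → ℤ) → MKer 4 FF)
    (AG : ℕ → MKer 4 FG) (𝒱G : ℕ → Fin 4 → (Fin 4 → ℤ) → MKer 4 FG) (𝒲G : ℕ → Fin 4 → (Fin 4 → ℤ) → Fin 4 → (Fin 4 → ℤ) → MKer 4 FG)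
    (𝒲Δ : ℕ → Fin (3 + 1) → Site (3 + 1) → Fin (3 + 1) → Site (3 + 1) → MKer (3 + 1) (Fib 3))
    (hWΔ₂ : ∀ j : ℕ, ∃ Cw δw : ℝ, 0 < δw ∧ VertexFamily₂ (𝒲Δ j) (Lc ^ (j + 1)) Cw δw)
    (hlawΔ : ∀ j : ℕ, 1 ≤ j → ∀ (μ ν : Fin 4) (z : Fin 4 → ℤ),
      hessKer (AN (Roots.ctr Lc) j) (VN (Roots.ctr Lc) P j) (WN (Roots.ctr Lc) P j + 𝒲Δ j) μ ν z
        = hessKer (AF j) (𝒱F j) (𝒲F j) μ ν z + hessKer (AG j) (𝒱G j) (𝒲G j) μ ν z)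
    (hF₁ : ∀ (μ ν : Fin 4) (z : Fin 4 → ℤ),
      hessKer (AF 1) (𝒱F 1) (𝒲F 1) μ ν z
        = (Lc : ℝ) ^ 8 * dressedEntry (wStep Lc 1) (TshotOf Lc (JcComp hLc N cΛ cB (Roots.ctr Lc) P) 1) ((Lc : ℤ) • z) μ ν)
    (htrΔ : ∀ j : ℕ, 1 ≤ j → ∀ (μ ν : Fin 4) (z : Fin 4 → ℤ),
      hessKer (AF (j + 1)) (𝒱F (j + 1)) (𝒲F (j + 1)) μ ν z
        = (Lc : ℝ) ^ 8 * dressedEntry (wStep Lc (j + 1))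
            (hessKer (AN (Roots.ctr Lc) j) (VN (Roots.ctr Lc) P j) (WN (Roots.ctr Lc) P j + 𝒲Δ j)) ((Lc : ℤ) • z) μ ν)
    (hG : ∀ j : ℕ, 1 ≤ j → ∀ (μ ν : Fin 4) (z : Fin 4 → ℤ),
      hessKer (AG j) (𝒱G j) (𝒲G j) μ ν z = TbalOf Lc (JsB12CombShSym hLc N (symTablesAn1S2 3 Lc cΛ) cΛ cB) j μ ν z)
    (hT0 : ∀ j (c e : Fin 4), HasSum (TbalOf Lc (JsB12CombShSym hLc N (symTablesAn1S2 3 Lc cΛ) cΛ cB) j c e) 0)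
    (hT1 : ∀ j (c e ρ : Fin 4), HasSum (fun t : Fin 4 → ℤ => t ρ • TbalOf Lc (JsB12CombShSym hLc N (symTablesAn1S2 3 Lc cΛ) cΛ cB) j c e t) 0)
    (hDΔtr : ∀ j : ℕ, 1 ≤ j → ∀ (μ ν : Fin 4) (z : Fin 4 → ℤ),
      -(1 / 2 : ℝ) * tadpole (AN (Roots.ctr Lc) (j + 1)) (𝒲Δ (j + 1) μ 0 ν z)
        = (Lc : ℝ) ^ 8 * dressedEntry (wStep Lc (j + 1))
            (fun c e t => -(1 / 2 : ℝ) * tadpole (AN (Roots.ctr Lc) j) (𝒲Δ j c 0 e t)) ((Lc : ℤ) • z) μ ν)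
    -- THE THREE LATTICE FOLDS OF THE RAW DOOR TADPOLE AT THE BASE (G2-M2′ at n = 0)
    (hM0₁ : ∀ c e : Fin 4, ∑' z : Fin 4 → ℤ, tadpole (AN (Roots.ctr Lc) 1) (𝒲Δ 1 c 0 e z) = 0)
    (hM1₁ : ∀ c e ρ : Fin 4, ∑' z : Fin 4 → ℤ, (z ρ : ℝ) * tadpole (AN (Roots.ctr Lc) 1) (𝒲Δ 1 c 0 e z) = 0)
    (hM2₁ : ∀ κ l c e : Fin 4, ∑' z : Fin 4 → ℤ, ((z κ : ℝ) * (z l : ℝ)) * tadpole (AN (Roots.ctr Lc) 1) (𝒲Δ 1 c 0 e z) = 0) :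
    D1Tel Lc (JsB12CombShSym hLc N (symTablesAn1S2 3 Lc cΛ) cΛ cB) (JcComp hLc N cΛ cB (Roots.ctr Lc) P) :=
  d1Tel_JcComp_ctr_nested_of_hessKer_laws_fedW_fed_wStep hLc N cΛ cB P AF 𝒱F 𝒲F AG 𝒱G 𝒲G 𝒲Δ
    (fun j μ ν z => by
      obtain ⟨Cw, δw, hδw, hW⟩ := hWΔ₂ j
      exact loc_of_vertexFamily₂ hW hδw μ 0 ν z)
    hlawΔ hF₁ htrΔ hG hT0 hT1
    (fun j _ c e => absMoment₂_tadpoleDefect (spr_AN (Roots.ctr Lc) j) (hWΔ₂ j) (Nat.one_le_pow _ _ (Nat.pos_of_neZero Lc)) _ c e) hDΔtr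
    (fun c e => hasSum_const_mul_of_tsum_eq_zero
      (absMoment₂_tadpolePart (spr_AN (Roots.ctr Lc) 1) (hWΔ₂ 1) (Nat.one_le_pow _ _ (Nat.pos_of_neZero Lc)) c e) (hM0₁ c e) _)
    (fun c e ρ => hasSum_coord_smul_of_tsum_eq_zero
      (absMoment₂_tadpolePart (spr_AN (Roots.ctr Lc) 1) (hWΔ₂ 1) (Nat.one_le_pow _ _ (Nat.pos_of_neZero Lc)) c e) ρ (hM1₁ c e ρ) _)
    (m2Tensor_eq_zero_of_tsum_coord2 (T := fun c e z => tadpole (AN (Roots.ctr Lc) 1) (𝒲Δ 1 c 0 e z)) hM2₁ _)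

/-- [folklore] **THE READ-OUT-LEVEL TWIN OF THE BASE-ONLY SHAPE** (channel `(μ, ν)`): the same rows with the ONE (1.22) READ-OUT COMPONENT of the base fold
`hM2F₁ : ∑' x, x_μ x_ν·tadpole (AN 1) (𝒲Δ 1 μ 0 ν x) = 0` in place of `hM2₁` ⟹ the lead's `D1Sum Lc Js (JcComp … (Roots.ctr Lc) P) μ ν`. -/
theorem d1Sum_JcComp_ctr_nested_of_fedW_moments_fed_wStep (hLc : Odd Lc) (N : ℕ) (cΛ cB : ℝ) (P : Pins)
    (AF : ℕ → MKer 4 FF) (𝒱F : ℕ → Fin 4 → (Fin 4 → ℤ) → MKer 4 FF) (𝒲F : ℕ → Fin 4 → (Fin 4 → ℤ) → Fin 4 → (Fin 4 → ℤ) → MKer 4 FF)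
    (AG : ℕ → MKer 4 FG) (𝒱G : ℕ → Fin 4 → (Fin 4 → ℤ) → MKer 4 FG) (𝒲G : ℕ → Fin 4 → (Fin 4 → ℤ) → Fin 4 → (Fin 4 → ℤ) → MKer 4 FG)
    (𝒲Δ : ℕ → Fin (3 + 1) → Site (3 + 1) → Fin (3 + 1) → Site (3 + 1) → MKer (3 + 1) (Fib 3))
    (hWΔ₂ : ∀ j : ℕ, ∃ Cw δw : ℝ, 0 < δw ∧ VertexFamily₂ (𝒲Δ j) (Lc ^ (j + 1)) Cw δw) (μ ν : Fin 4)
    (hlawΔ : ∀ j : ℕ, 1 ≤ j → ∀ (μ ν : Fin 4) (z : Fin 4 → ℤ),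
      hessKer (AN (Roots.ctr Lc) j) (VN (Roots.ctr Lc) P j) (WN (Roots.ctr Lc) P j + 𝒲Δ j) μ ν z
        = hessKer (AF j) (𝒱F j) (𝒲F j) μ ν z + hessKer (AG j) (𝒱G j) (𝒲G j) μ ν z)
    (hF₁ : ∀ (μ ν : Fin 4) (z : Fin 4 → ℤ),
      hessKer (AF 1) (𝒱F 1) (𝒲F 1) μ ν z
        = (Lc : ℝ) ^ 8 * dressedEntry (wStep Lc 1) (TshotOf Lc (JcComp hLc N cΛ cB (Roots.ctr Lc) P) 1) ((Lc : ℤ) • z) μ ν)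
    (htrΔ : ∀ j : ℕ, 1 ≤ j → ∀ (μ ν : Fin 4) (z : Fin 4 → ℤ),
      hessKer (AF (j + 1)) (𝒱F (j + 1)) (𝒲F (j + 1)) μ ν z
        = (Lc : ℝ) ^ 8 * dressedEntry (wStep Lc (j + 1))
            (hessKer (AN (Roots.ctr Lc) j) (VN (Roots.ctr Lc) P j) (WN (Roots.ctr Lc) P j + 𝒲Δ j)) ((Lc : ℤ) • z) μ ν)
    (hG : ∀ j : ℕ, 1 ≤ j → ∀ (μ ν : Fin 4) (z : Fin 4 → ℤ),
      hessKer (AG j) (𝒱G j) (𝒲G j) μ ν z = TbalOf Lc (JsB12CombShSym hLc N (symTablesAn1S2 3 Lc cΛ) cΛ cB) j μ ν z)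
    (hT0 : ∀ j (c e : Fin 4), HasSum (TbalOf Lc (JsB12CombShSym hLc N (symTablesAn1S2 3 Lc cΛ) cΛ cB) j c e) 0)
    (hT1 : ∀ j (c e ρ : Fin 4), HasSum (fun t : Fin 4 → ℤ => t ρ • TbalOf Lc (JsB12CombShSym hLc N (symTablesAn1S2 3 Lc cΛ) cΛ cB) j c e t) 0)
    (hDΔtr : ∀ j : ℕ, 1 ≤ j → ∀ (μ ν : Fin 4) (z : Fin 4 → ℤ),
      -(1 / 2 : ℝ) * tadpole (AN (Roots.ctr Lc) (j + 1)) (𝒲Δ (j + 1) μ 0 ν z)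
        = (Lc : ℝ) ^ 8 * dressedEntry (wStep Lc (j + 1))
            (fun c e t => -(1 / 2 : ℝ) * tadpole (AN (Roots.ctr Lc) j) (𝒲Δ j c 0 e t)) ((Lc : ℤ) • z) μ ν)
    (hM0₁ : ∀ c e : Fin 4, ∑' z : Fin 4 → ℤ, tadpole (AN (Roots.ctr Lc) 1) (𝒲Δ 1 c 0 e z) = 0)
    (hM1₁ : ∀ c e ρ : Fin 4, ∑' z : Fin 4 → ℤ, (z ρ : ℝ) * tadpole (AN (Roots.ctr Lc) 1) (𝒲Δ 1 c 0 e z) = 0)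
    (hM2F₁ : ∑' x : Fin 4 → ℤ, ((x μ : ℝ) * (x ν : ℝ)) * tadpole (AN (Roots.ctr Lc) 1) (𝒲Δ 1 μ 0 ν x) = 0) :
    D1Sum Lc (JsB12CombShSym hLc N (symTablesAn1S2 3 Lc cΛ) cΛ cB) (JcComp hLc N cΛ cB (Roots.ctr Lc) P) μ ν :=
  d1Sum_JcComp_ctr_nested_of_hessKer_laws_fedW_fed_wStep hLc N cΛ cB P AF 𝒱F 𝒲F AG 𝒱G 𝒲G 𝒲Δ
    (fun j μ' ν' z => by
      obtain ⟨Cw, δw, hδw, hW⟩ := hWΔ₂ j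
      exact loc_of_vertexFamily₂ hW hδw μ' 0 ν' z)
    μ ν hlawΔ hF₁ htrΔ hG hT0 hT1
    (fun j _ c e => absMoment₂_tadpoleDefect (spr_AN (Roots.ctr Lc) j) (hWΔ₂ j) (Nat.one_le_pow _ _ (Nat.pos_of_neZero Lc)) _ c e) hDΔtr
    (fun c e => hasSum_const_mul_of_tsum_eq_zero
      (absMoment₂_tadpolePart (spr_AN (Roots.ctr Lc) 1) (hWΔ₂ 1) (Nat.one_le_pow _ _ (Nat.pos_of_neZero Lc)) c e) (hM0₁ c e) _)
    (fun c e ρ => hasSum_coord_smul_of_tsum_eq_zero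
      (absMoment₂_tadpolePart (spr_AN (Roots.ctr Lc) 1) (hWΔ₂ 1) (Nat.one_le_pow _ _ (Nat.pos_of_neZero Lc)) c e) ρ (hM1₁ c e ρ) _)
    (secondMoment_eq_zero_of_tsum_coord2 (T := fun c e z => tadpole (AN (Roots.ctr Lc) 1) (𝒲Δ 1 c 0 e z)) μ ν hM2F₁ _)

end BaseOnly

end Summit.QuantumFields.BalabanUV.Beta.FP.StepRecursionFeedNestedCompDoorMoments

end
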